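import Mathlib
import Summits.KontsevichZagierPeriods.KontsevichZagierPeriods.Theorems.SoloInformedHookChain
import HarnessLib
import HarnessLib.Audit

/-!
# SoloInformed — the hook identities: the class of the placement sum (F4)

Solo programme `solo-KontsevichZagierPeriods-informed`, session s54 (PROGRAMME LIII).

THEOREM (`soloInformed_hookSum_class`, `SoloInformedHookStage.repA_class`).  When all
coordinates are placed (`cum_K(β) + |ℓ| = M + 1`), a representation on the open cube with
integrand the placement sum `HookSum(ℓ)` has class

  `Σ_{final states (β', K')} mzvClass (idx β') = Σ (soloInformedHookWords (idx β) pos |ℓ|).map mzvClass`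

in `𝒫 = KZ.FormalPeriodRing`: the placement sum is the sum of the chain functions of the final
states (file F1d), each final state is a valid block labelling whose chain function is the
integrand of `BRep β'` (class `mzvClass (idx β')` by rule (2), `soloInformed_bRep_class`), and
rule (1) is additive over a list of representations with a common domain
(`soloInformed_toFormalPeriod_eq_listSum`).  Combined with the chain of scale band steps
(file F3c) this evaluates the first `A`-side of a hook stage:

  `⟦A⟧ = Σ (soloInformedHookWords (idx β) pos |bs ++ c :: cs|).map mzvClass`,

the series side of Kaneko–Yamamoto's integral–series identity for hook indices.

INTEGRABILITY FROM THE BACK (`SoloInformedHookStage.integrableOn_fA`).  No analytic input is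
needed: the last `B`-side `[(0,1)^{M+1}, HookSum(all)]` is a finite sum of `BRep` integrands,
hence integrable (`soloInformed_integrableOn_hookSum`); THEOREM XLIX's own transfer
`f_B ∈ L¹ ⟹ f_A ∈ L¹` (`SoloInformedScalePre.integrableOn_fA_of_fB`) then climbs the chain, each
`A`-side being the previous `B`-side.  So `repA_class'` holds for EVERY fully placed hook stage,
unconditionally.

References: M. Kaneko, S. Yamamoto, arXiv:1605.03117, Thm 4.1; M. Hoffman, Pacific J. Math. 152
(1992) Thm 5.1; Kontsevich–Zagier 2001 §1.2 rules (1), (2) [KontsevichZagier2001].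

Place in the programme (added s65): this file is consumed by `SoloInformedHookBase` (the initial
hook stage and THEOREM LIII `soloInformed_hook_identity`) and, through it, by `SoloInformedHook`
(the Kaneko–Yamamoto form of the hook identity and its low-weight instances).
-/

noncomputable section

open MeasureTheory Set MvPolynomial
open Literature.ModelTheory.ExponentialFields Literature.NumberTheory.Transcendental
open Literature.NumberTheory.Transcendental.KZ

namespace Summit.KontsevichZagierPeriods.KontsevichZagierPeriods.Theorems

/-! ## 1. Rule (1) over a list of representations -/

/-- **List integrand additivity, on classes.** If every `r' ∈ l` has the domain of `r` and
`r.integrand = Σ_{r' ∈ l} r'.integrand` on it, then `⟦r⟧ = Σ_{r' ∈ l} ⟦r'⟧` in `𝒫`.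
[Kontsevich–Zagier 2001, §1.2 rule (1)] -/
theorem soloInformed_toFormalPeriod_eq_listSum {n : ℕ} (r : IntegralRep n)
    (l : List (IntegralRep n)) (hd : ∀ r' ∈ l, r'.domain = r.domain)
    (h : EqOn r.integrand (fun x => (l.map fun r' => r'.integrand x).sum) r.domain) :
    toFormalPeriod (of r) = (l.map fun r' => toFormalPeriod (of r')).sum := by
  have key := soloInformed_of_sub_sum_mem_relations r (fun i : Fin l.length => l[(i : ℕ)])
    (fun i => hd _ (List.getElem_mem i.2)) fun x hx => by
      rw [h hx]
      beta_reduce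
      rw [← List.ofFn_getElem_eq_map (l := l) (f := fun r' : IntegralRep n => r'.integrand x),
        List.sum_ofFn]
  rw [toFormalPeriod_eq_iff.2 key, map_sum,
    ← List.ofFn_getElem_eq_map (l := l) (f := fun r' : IntegralRep n => toFormalPeriod (of r')),
    List.sum_ofFn]

/-! ## 2. The class of a placement sum on the cube -/

/-- **`⟦(0,1)^{M+1}, HookSum(ℓ)⟧ = Σ (HookWords (idx β) pos |ℓ|).map mzvClass`** when all
coordinates are placed (`cum_K(β) + |ℓ| = M + 1`; `(β, K)` partially valid, `pos ≤ K`, `ℓ`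
pairwise distinct with labels `> K`). [Kaneko–Yamamoto arXiv:1605.03117 Thm 4.1, series side] -/
theorem soloInformed_hookSum_class {M : ℕ} {β : Fin (M + 1) → ℕ} {K pos : ℕ}
    {ℓ : List (Fin (M + 1))} (hL : soloInformedIsLabK β K) (hpos : pos ≤ K)
    (hub : ∀ x ∈ ℓ, K < β x) (hnd : ℓ.Nodup) (hcum : soloInformedCum β K + ℓ.length = M + 1)
    (r : IntegralRep (M + 1)) (hd : r.domain = soloInformedOpenCube (M + 1))
    (hi : EqOn r.integrand (fun x => soloInformedHookSum x β K pos ℓ)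
      (soloInformedOpenCube (M + 1))) :
    toFormalPeriod (of r) =
      ((soloInformedHookWords (soloInformedIdx β (K + 1)) pos ℓ.length).map mzvClass).sum := by
  have hval : ∀ p ∈ soloInformedHookStates β K pos ℓ, soloInformedIsLab p.1 p.2 :=
    fun p hp => soloInformed_states_isLab hL hpos hub hnd hcum hp
  -- the representations `BRep β'` of the final states
  set reps : List (IntegralRep (M + 1)) :=
    (soloInformedHookStates β K pos ℓ).attach.map fun p => soloInformedBRep p.1.1 (hval p.1 p.2)
    with hreps
  have h1 : toFormalPeriod (of r) = (reps.map fun r' => toFormalPeriod (of r')).sum := by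
    refine soloInformed_toFormalPeriod_eq_listSum r reps (fun r' hr' => ?_) fun x hx => ?_
    · rw [hreps] at hr'
      obtain ⟨p, -, rfl⟩ := List.mem_map.1 hr'
      rw [hd]
      exact soloInformed_bRep_domain _ _
    · rw [hd] at hx
      rw [hi hx]
      show soloInformedHookSum x β K pos ℓ = (reps.map fun r' => r'.integrand x).sum
      rw [hreps, soloInformed_hookSum_eq_states, List.map_map,
        ← List.attach_map_val (l := soloInformedHookStates β K pos ℓ) (f := soloInformedStateG x)]
      congr 1
      refine List.map_congr_left fun p _ => ?_
      exact soloInformed_stateG_eq_bRep_integrand x (hval p.1 p.2)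
  rw [h1, hreps, List.map_map, ← soloInformed_states_words ℓ β K pos hpos hub hnd, List.map_map,
    ← List.attach_map_val (l := soloInformedHookStates β K pos ℓ)]
  congr 1
  refine List.map_congr_left fun p _ => ?_
  exact soloInformed_bRep_class _ _

/-! ## 3. The class of the first `A`-side of a hook stage -/

namespace SoloInformedHookStage

variable {M : ℕ} (S : SoloInformedHookStage (M + 1))

/-- **`⟦A⟧ = Σ (HookWords (idx β) pos |bs ++ c :: cs|).map mzvClass`** for a hook stage with
integrable first `A`-side and all coordinates placed (`cum_K(β) + |bs ++ c :: cs| = M + 1`):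
the chain of scale band steps (file F3c) followed by the class of the placement sum.
[KZ 2001 §1.2 rules (1)–(3); Kaneko–Yamamoto arXiv:1605.03117 Thm 4.1] -/
theorem repA_class (hA : IntegrableOn S.pre.fA S.pre.T₀.DA)
    (hcum : soloInformedCum S.β S.K + (S.bs ++ S.c :: S.cs).length = M + 1) :
    toFormalPeriod (of (S.pre.toDatum hA).repA) =
      ((soloInformedHookWords (soloInformedIdx S.β (S.K + 1)) S.pos
        (S.bs ++ S.c :: S.cs).length).map mzvClass).sum := by
  obtain ⟨r, hd, hi, hrel⟩ := S.chain hA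
  rw [toFormalPeriod_eq_iff.2 hrel]
  exact soloInformed_hookSum_class S.isLabK S.pos_le S.lt_β S.nodup hcum r hd hi

end SoloInformedHookStage

/-! ## 4. Integrability from the back -/

namespace SoloInformedScalePre

variable {n : ℕ} (S : SoloInformedScalePre n)

/-- The scale datum of a pre-datum with integrable `B`-side (THEOREM XLIX's native input). -/
def ofB (hB : IntegrableOn S.fB S.T₀.D) : SoloInformedScaleDatum n where
  i := S.i
  P := S.P
  Q := S.Q
  Ω := S.Ω
  C := S.C
  D := S.D
  isSemialgebraic_D := S.isSemialgebraic_D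
  update_mem := S.update_mem
  mem_Ioo := S.mem_Ioo
  vars_Ω := S.vars_Ω
  vars_C := S.vars_C
  Ω_bound := S.Ω_bound
  C_pos := S.C_pos
  Q_ne := S.Q_ne
  mono := S.mono
  integrableOn_fB := hB

/-- **`f_B ∈ L¹(D) ⟹ f_A ∈ L¹(D ∩ {ω < xᵢ})`** (`SoloInformedScaleDatum.integrableOn_fA` of `ofB`). -/
theorem integrableOn_fA_of_fB (hB : IntegrableOn S.fB S.T₀.D) : IntegrableOn S.fA S.T₀.DA :=
  (S.ofB hB).integrableOn_fA

end SoloInformedScalePre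

/-- **A full placement sum is integrable on the cube**: it is the finite sum of the integrands
of the representations `BRep β'` of its final states. -/
theorem soloInformed_integrableOn_hookSum {M : ℕ} {β : Fin (M + 1) → ℕ} {K pos : ℕ}
    {ℓ : List (Fin (M + 1))} (hL : soloInformedIsLabK β K) (hpos : pos ≤ K)
    (hub : ∀ x ∈ ℓ, K < β x) (hnd : ℓ.Nodup) (hcum : soloInformedCum β K + ℓ.length = M + 1) :
    IntegrableOn (fun x => soloInformedHookSum x β K pos ℓ) (soloInformedOpenCube (M + 1)) := by
  have hval : ∀ p ∈ soloInformedHookStates β K pos ℓ, soloInformedIsLab p.1 p.2 :=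
    fun p hp => soloInformed_states_isLab hL hpos hub hnd hcum hp
  have h : (fun x => soloInformedHookSum x β K pos ℓ) =
      fun x => ∑ i : Fin (soloInformedHookStates β K pos ℓ).length,
        (soloInformedBRep ((soloInformedHookStates β K pos ℓ)[(i : ℕ)]).1
          (hval _ (List.getElem_mem i.2))).integrand x := by
    funext x
    rw [soloInformed_hookSum_eq_states, ← List.ofFn_getElem_eq_map (l := soloInformedHookStates β K pos ℓ)
      (f := soloInformedStateG x), List.sum_ofFn]
    exact Finset.sum_congr rfl fun i _ => soloInformed_stateG_eq_bRep_integrand x _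
  rw [h]
  exact integrable_finsetSum _ fun i _ => by
    have hi := (soloInformedBRep ((soloInformedHookStates β K pos ℓ)[(i : ℕ)]).1
      (hval _ (List.getElem_mem i.2))).integrableOn
    rwa [soloInformed_bRep_domain] at hi

namespace SoloInformedHookStage

variable {M : ℕ}

/-- Integrability of every `A`-side of a fully placed chain, by induction from the back. -/
theorem integrableOn_fA_aux : ∀ (n : ℕ) (S : SoloInformedHookStage (M + 1)), S.cs.length = n →
    soloInformedCum S.β S.K + (S.bs ++ S.c :: S.cs).length = M + 1 →
    IntegrableOn S.pre.fA S.pre.T₀.DA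
  | 0, S, hn, hcum => by
    have hS : S.cs = [] := List.length_eq_zero_iff.1 hn
    have hD : S.pre.T₀.D = soloInformedOpenCube (M + 1) := by
      rw [SoloInformedScalePre.T₀_D, pre_D, hS, soloInformedChainSet_nil, inter_univ]
    have hl : ∀ x ∈ S.bs ++ [S.c], S.K < S.β x := S.lt_β_bsc
    have hI := soloInformed_integrableOn_hookSum (pos := S.pos) S.isLabK S.pos_le hl S.nodup_bsc
      (by simpa [hS] using hcum)
    refine S.pre.integrableOn_fA_of_fB ?_
    rw [hD]
    refine hI.congr_fun (fun x hx => ?_) (soloInformed_measurableSet_openCube _)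
    rw [S.pre_fB hx, hS]
    simp
  | n + 1, S, hn, hcum => by
    obtain ⟨c', cs', hS⟩ : ∃ c' cs', S.cs = c' :: cs' := by
      cases hS : S.cs with
      | nil => rw [hS] at hn; simp at hn
      | cons c' cs' => exact ⟨c', cs', rfl⟩
    have hn' : (S.next c' cs' hS).cs.length = n := by
      rw [hS] at hn
      simpa [next] using hn
    have hcum' : soloInformedCum (S.next c' cs' hS).β (S.next c' cs' hS).K +
        ((S.next c' cs' hS).bs ++ (S.next c' cs' hS).c :: (S.next c' cs' hS).cs).length = M + 1 := by
      simpa [next, hS] using hcum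
    have hA' := integrableOn_fA_aux n (S.next c' cs' hS) hn' hcum'
    refine S.pre.integrableOn_fA_of_fB ?_
    rw [← S.next_DA c' cs' hS]
    exact hA'.congr_fun (fun x hx => (S.next_fA c' cs' hS (by rwa [S.next_DA c' cs' hS] at hx)).symm)
      (S.next c' cs' hS).pre.T₀.measurableSet_DA

variable (S : SoloInformedHookStage (M + 1))

/-- **Every fully placed hook stage has an integrable first `A`-side.** -/
theorem integrableOn_fA (hcum : soloInformedCum S.β S.K + (S.bs ++ S.c :: S.cs).length = M + 1) :
    IntegrableOn S.pre.fA S.pre.T₀.DA :=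
  integrableOn_fA_aux S.cs.length S rfl hcum

/-- **`⟦A⟧ = Σ (HookWords (idx β) pos |bs ++ c :: cs|).map mzvClass`, unconditionally** for a
fully placed hook stage. [KZ 2001 §1.2 rules (1)–(3); Kaneko–Yamamoto arXiv:1605.03117 Thm 4.1] -/
theorem repA_class' (hcum : soloInformedCum S.β S.K + (S.bs ++ S.c :: S.cs).length = M + 1) :
    toFormalPeriod (of (S.pre.toDatum (S.integrableOn_fA hcum)).repA) =
      ((soloInformedHookWords (soloInformedIdx S.β (S.K + 1)) S.pos
        (S.bs ++ S.c :: S.cs).length).map mzvClass).sum :=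
  S.repA_class _ hcum

end SoloInformedHookStage

end Summit.KontsevichZagierPeriods.KontsevichZagierPeriods.Theorems
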